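import Literature.MathematicalPhysics.QuantumFieldTheory.Balaban1983to89.B3CxiPropagator
import Literature.MathematicalPhysics.QuantumFieldTheory.Balaban1983to89.B3Eq324Parseval

/-!
# `Balaban1983to89.B3Eq327Cxi` — T. Bałaban, *(Higgs)₂,₃ quantum fields in a finite volume. III. Renormalization*,
Commun. Math. Phys. **88** (1983) 411–445 [Balaban1983Higgs3], p. 441 [PDF 31]: the identity **(3.27)** FOR THE FREE
PROPAGATOR C^ξ ITSELF — the typed display `B3Sect3VectorSelfEnergy.Eq327 d ξ τ` PROVED (ξ > 0)

statement-level skeleton of published theorems with citation tags; proofs where landed; nothing here is a claim about the Yang–Mills mass gap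

PDF held: `paper:balaban1983-higgs-2-3-quantum-fields-finite-volume` (journal page = PDF page + 410).  Read: p. 441 [PDF 31] on the ×2
render `run/shared/lean/pub/pub-balaban/b2b-balaban-ref1/pages/1983-cmp88-higgs23-III/1983-cmp88-higgs23-III-p031-x2.png`.

CITATION HEADER (lean-in-tree rule).  Part of the lit-balaban TYPED SKELETON (HOME `run/shared/lean/pub/lit-balaban/`), reader/typer
seat r15 (fold owner of B3), generation 4; companion of `B3Sect3VectorSelfEnergy` (r15: (3.27) typed as `Eq327`, its algebraic
content PROVED for even FINITELY supported kernels `eq327_of_even_finsupp`) and of `B3CxiPropagator` (r15 g4: C^ξ ≥ 0 and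
Σ_y (1 + |y|₁)^m C^ξ(y) < ∞ by the Neumann series).  WHAT IS REPRODUCED: row **B3.Eq3.25-3.32** of `HOME/lit-balaban-r15/ROWS-B3.md`,
member (3.27) — «(3.27) for C^ξ itself» was the open convergence bookkeeping (transcript note T5 of the companion).

THE PRINTED TEXT (verbatim, p. 441 [PDF 31]).  *"For the expression Π^{(L^{−j₀},j₀)}_{μμ′ν}, we have to consider the term
tr q² Σ_{y′} ξ^d[−(C^ξ∂^{ξ*}_{μ′})(y−y′)(C^ξ∂^{ξ*}_μ)(y′−y)(y′_ν−y_ν) + C^ξ(y−y′)(∂^ξ_{μ′}C^ξ∂^{ξ*}_μ)(y′−y)(y′_ν−y_ν)] = …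
= ½ tr q² Σ_{y′} ξ^d(C^ξ(y′+ξe_μ) − C^ξ(y′−ξe_μ))(∂^ξ_{μ′}C^ξ)(y′)δ_{μν} − (μ↔μ′). (3.27) We have used the identities C^ξ(−y′) = C^ξ(y′),
(∂^ξ_μC^ξ)(−y′) = (∂^{ξ*}_μC^ξ)(y′) and the integration by parts formula. Furthermore, for the last expression we have … (3.28) which
is symmetric in μ, μ′, hence finally the term (3.27) is equal to 0."*

WHAT IS PROVED, and how (theorems only).  §1 the convergence bookkeeping: for an EVEN kernel C on ξℤ^d with Σ_z|C(z)| < ∞ and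
Σ_z|z_ν||C(z)| < ∞ (all ν), every lattice sum of the p. 441 computation converges absolutely (products of translates,
first-moment products), and the route of `eq327_of_even_finsupp` — translation y′ = z + y, the two printed identities, pair sums
P(v) = Σ_zC(z)C(z+v), the first-moment reflection identity Σ_z z_νC(z)C(z+v) = −½v_νP(v) — goes through verbatim:
`eq327_of_even_summable` (first member of (3.27) = last member).  §2 C^ξ is in that class (`summable_abs_Cxi`,
`summable_coord_mul_Cxi`, from `B3CxiPropagator.summable_weight_Cxi`/`Cxi_nonneg`), hence **`eq327_holds (hξ : 0 < ξ) (τ) :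
Eq327 d ξ τ`**; and the printed conclusion *"hence finally the term (3.27) is equal to 0"* now needs only the diagonality of
(3.28): `lhs327_eq_zero_of_eq328'` (input `Eq328 d ξ`; its second equality is the companion's `eq328_second`, its first
equality — lattice sum = momentum integral — is seat p03's `B3Eq324Parseval` line).  tr q² is the real number `τ`; the middle
member of (3.27) is not typed (as in the companion).  Unit `lit-balaban-r15` (literature-prover-lit-balaban-r15-g4-0), 2026-08-21.

v1.1 (append-only, r15 gen 4): §3 — with seat p03's `B3Eq324Parseval.eq328_holds` ((3.28) incl. its FIRST equality, Plancherel on ξℤ^d, p249197) imported, the printed conclusion of p. 441 *"which is symmetric in μ, μ′, hence finally the term (3.27) is equal to 0"* is PROVED UNCONDITIONALLY for C^ξ (ξ > 0): `lhs327_Cxi_eq_zero` — the first member of (3.27) vanishes for every y, μ, μ′, ν (`eq327_holds` ∘ `eq328_holds` ∘ r15 g3's `lhs327_eq_zero_of_eq328`).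

v1.2 (append-only, r15 gen 4): §4 — the printed MIDDLE member of (3.27), read on the page render named above (the OCR of PDF p. 31 is
illegible at the display; the render is not): *"= ½ tr q² Σ_{y′} ξ^d[−(∂^{ξ*}_μC^ξ)(y′)(∂^ξ_{μ′}C^ξ)(y′)y′_ν + C^ξ(y′)(∂^{ξ*}_μ∂^ξ_{μ′}C^ξ)(y′)y′_ν
+ (∂^ξ_μC^ξ)(y′)(∂^{ξ*}_{μ′}C^ξ)(y′)y′_ν − C^ξ(y′)(∂^{ξ*}_{μ′}∂^ξ_μC^ξ)(y′)y′_ν]"* — typed WITH BODY (`mid327Of` for a kernel C,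
`mid327` at C = C^ξ) and the full printed three-member chain PROVED: first member = middle member (`lhs327Of_eq_mid327Of`:
translation y′ ↦ y′ + y, the two printed identities *"C^ξ(−y′) = C^ξ(y′), (∂^ξ_μC^ξ)(−y′) = (∂^{ξ*}_μC^ξ)(y′)"* and the average over
the reflection y′ ↦ −y′, for every even kernel of the summability class), middle member = last member (`mid327Of_eq_rhs327`, *"and the
integration by parts formula"* = §1), and for C^ξ itself (ξ > 0) `lhs327_eq_mid327`, `mid327_eq_rhs327`, `mid327_eq_zero`.
-/

namespace Literature.MathematicalPhysics.QuantumFieldTheory.Balaban1983to89.B3Eq327Cxi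

open B3Sect3VectorSelfEnergy B3CxiPropagator

variable {d : ℕ}

/-! ## 1. Summable kernels: the convergence bookkeeping (T5) -/

section SummableKernels

variable {C : ZSite d → ℝ}

/-- kernel: translation invariance of the lattice sums, Σ_z F(z + u) = Σ_z F(z). [folklore] -/
private theorem tsum_translate (F : ZSite d → ℝ) (u : ZSite d) : ∑' z : ZSite d, F (z + u) = ∑' z : ZSite d, F z :=
  Equiv.tsum_eq (Equiv.addRight u) F

/-- kernel: a translate of a summable family is summable. [folklore] -/
private theorem summable_translate {F : ZSite d → ℝ} (hF : Summable F) (u : ZSite d) :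
    Summable fun z : ZSite d => F (z + u) :=
  (Equiv.summable_iff (Equiv.addRight u)).mpr hF

/-- kernel: a summable kernel is bounded by its ℓ¹ norm. [folklore] -/
private theorem abs_le_tsum (h0 : Summable fun z => |C z|) (z : ZSite d) : |C z| ≤ ∑' w, |C w| :=
  h0.le_tsum z fun _ _ => abs_nonneg _

/-- kernel: products of translates of an ℓ¹ kernel are summable. [folklore] -/
private theorem summable_mul_translates (h0 : Summable fun z => |C z|) (u' u : ZSite d) :
    Summable fun z : ZSite d => C (z + u') * C (z + u) := by
  refine Summable.of_norm_bounded ((summable_translate h0 u).mul_left (∑' w, |C w|)) fun z => ?_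
  rw [Real.norm_eq_abs, abs_mul]
  exact mul_le_mul_of_nonneg_right (abs_le_tsum h0 _) (abs_nonneg _)

/-- kernel: first-moment products of translates are summable when Σ|z_ν||C(z)| < ∞. [folklore] -/
private theorem summable_coord_mul_translates (h0 : Summable fun z => |C z|)
    (h1 : ∀ ν, Summable fun z : ZSite d => |(z ν : ℝ)| * |C z|) (ν : Fin d) (u' u : ZSite d) :
    Summable fun z : ZSite d => (z ν : ℝ) * (C (z + u') * C (z + u)) := by
  set B := ∑' w, |C w| with hB
  have hg : Summable fun z : ZSite d =>
      B * (|((z + u') ν : ℝ)| * |C (z + u')|) + B * |(u' ν : ℝ)| * |C (z + u')| :=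
    ((summable_translate (h1 ν) u').mul_left B).add ((summable_translate h0 u').mul_left (B * |(u' ν : ℝ)|))
  refine Summable.of_norm_bounded hg fun z => ?_
  rw [Real.norm_eq_abs, abs_mul, abs_mul]
  have hz : |(z ν : ℝ)| ≤ |((z + u') ν : ℝ)| + |(u' ν : ℝ)| := by
    have : (z ν : ℝ) = ((z + u') ν : ℝ) - (u' ν : ℝ) := by simp
    rw [this]
    exact abs_sub _ _
  have hCu : |C (z + u)| ≤ B := abs_le_tsum h0 _
  have h1' : 0 ≤ |C (z + u')| := abs_nonneg _
  calc |(z ν : ℝ)| * (|C (z + u')| * |C (z + u)|) ≤ (|((z + u') ν : ℝ)| + |(u' ν : ℝ)|) * (|C (z + u')| * B) := by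
        gcongr
    _ = B * (|((z + u') ν : ℝ)| * |C (z + u')|) + B * |(u' ν : ℝ)| * |C (z + u')| := by ring

/-- kernel: the pair sums P(v) = Σ_z C(z)C(z+v) are even, P(−v) = P(v) (translation invariance). [folklore] -/
private theorem pairC_neg (v : ZSite d) :
    ∑' z : ZSite d, C z * C (z + -v) = ∑' z : ZSite d, C z * C (z + v) := by
  rw [← tsum_translate (fun z => C z * C (z + -v)) v]
  refine tsum_congr fun z => ?_
  rw [show z + v + -v = z by abel]
  ring

/-- kernel: the first moment Σ_z z_ν C(z)C(z+v) = −½ v_ν P(v) for an even kernel of the summability class (reflection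
z ↦ −z − v). [folklore] -/
private theorem moment_eq (hC : ∀ z, C (-z) = C z) (h0 : Summable fun z => |C z|)
    (h1 : ∀ ν, Summable fun z : ZSite d => |(z ν : ℝ)| * |C z|) (v : ZSite d) (ν : Fin d) :
    ∑' z : ZSite d, (z ν : ℝ) * (C z * C (z + v)) = -(1 / 2) * (v ν : ℝ) * ∑' z : ZSite d, C z * C (z + v) := by
  set F : ZSite d → ℝ := fun z => (z ν : ℝ) * (C z * C (z + v)) with hF
  have hrefl : ∑' z : ZSite d, F z = ∑' z : ZSite d, (-(v ν : ℝ) - z ν) * (C z * C (z + v)) := by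
    rw [← Equiv.tsum_eq (Equiv.subLeft (-v)) F]
    refine tsum_congr fun z => ?_
    simp only [hF, Equiv.subLeft_apply]
    rw [show -v - z + v = -z by abel, hC z, show -v - z = -(z + v) by abel, hC (z + v)]
    simp only [Pi.neg_apply, Pi.add_apply, Int.cast_neg, Int.cast_add]
    ring
  have hs1 : Summable F := by
    simpa only [hF, add_zero] using summable_coord_mul_translates h0 h1 ν 0 v
  have hs2 : Summable (fun z : ZSite d => (v ν : ℝ) * (C z * C (z + v))) := by
    simpa only [add_zero] using (summable_mul_translates h0 0 v).mul_left (v ν : ℝ)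
  have hsplit : ∑' z : ZSite d, (-(v ν : ℝ) - z ν) * (C z * C (z + v)) =
      -((v ν : ℝ) * ∑' z : ZSite d, C z * C (z + v)) - ∑' z : ZSite d, F z := by
    have : (fun z : ZSite d => (-(v ν : ℝ) - z ν) * (C z * C (z + v))) =
        fun z => -((v ν : ℝ) * (C z * C (z + v))) - F z := by
      funext z; simp only [hF]; ring
    rw [this, Summable.tsum_sub hs2.neg hs1, tsum_neg, ← tsum_mul_left]
  rw [hsplit] at hrefl
  linarith

/-- kernel: S(μ,μ′) of (3.28) in terms of pair sums: ξ^{d−1}[P(e_{μ′} − e_μ) − P(e_μ + e_{μ′})] (summability class).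
[folklore] -/
private theorem sum328Of_eq_pairC (ξ : ℝ) (h0 : Summable fun z => |C z|) (μ μ' : Fin d) :
    sum328Of ξ C μ μ' =
      ξ ^ d * ξ⁻¹ * ((∑' z : ZSite d, C z * C (z + (unitVec μ' - unitVec μ))) -
        ∑' z : ZSite d, C z * C (z + (unitVec μ + unitVec μ'))) := by
  have hA : ∑' z : ZSite d, C (z + unitVec μ) * C (z + unitVec μ') =
      ∑' z : ZSite d, C z * C (z + (unitVec μ' - unitVec μ)) := by
    rw [← tsum_translate (fun z => C z * C (z + (unitVec μ' - unitVec μ))) (unitVec μ)]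
    refine tsum_congr fun z => ?_
    rw [show z + unitVec μ + (unitVec μ' - unitVec μ) = z + unitVec μ' by abel]
  have hB : ∑' z : ZSite d, C (z + unitVec μ) * C z = ∑' z : ZSite d, C z * C (z + unitVec μ) :=
    tsum_congr fun z => by ring
  have hD : ∑' z : ZSite d, C (z - unitVec μ) * C (z + unitVec μ') =
      ∑' z : ZSite d, C z * C (z + (unitVec μ + unitVec μ')) := by
    rw [← tsum_translate (fun z => C z * C (z + (unitVec μ + unitVec μ'))) (-unitVec μ)]
    refine tsum_congr fun z => ?_
    rw [show z + -unitVec μ + (unitVec μ + unitVec μ') = z + unitVec μ' by abel, sub_eq_add_neg]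
  have hE : ∑' z : ZSite d, C (z - unitVec μ) * C z = ∑' z : ZSite d, C z * C (z + unitVec μ) := by
    rw [← tsum_translate (fun z => C z * C (z + unitVec μ)) (-unitVec μ)]
    refine tsum_congr fun z => ?_
    rw [show z + -unitVec μ + unitVec μ = z by abel, sub_eq_add_neg]
  have sA : Summable (fun z : ZSite d => C (z + unitVec μ) * C (z + unitVec μ')) :=
    summable_mul_translates h0 _ _
  have sB : Summable (fun z : ZSite d => C (z + unitVec μ) * C z) := by
    simpa only [add_zero] using summable_mul_translates h0 (unitVec μ) 0
  have sD : Summable (fun z : ZSite d => C (z - unitVec μ) * C (z + unitVec μ')) := by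
    simpa only [sub_eq_add_neg] using summable_mul_translates h0 (-unitVec μ) (unitVec μ')
  have sE : Summable (fun z : ZSite d => C (z - unitVec μ) * C z) := by
    simpa only [sub_eq_add_neg, add_zero] using summable_mul_translates h0 (-unitVec μ) 0
  have hexp : (fun y' : ZSite d => ξ ^ d * ((C (y' + unitVec μ) - C (y' - unitVec μ)) * pdiffZ ξ⁻¹ μ' C y')) =
      fun z => ξ ^ d * ξ⁻¹ * ((C (z + unitVec μ) * C (z + unitVec μ') - C (z + unitVec μ) * C z) -
        (C (z - unitVec μ) * C (z + unitVec μ') - C (z - unitVec μ) * C z)) := by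
    funext z; simp only [pdiffZ]; ring
  rw [sum328Of, hexp, tsum_mul_left, Summable.tsum_sub (sA.sub sB) (sD.sub sE), Summable.tsum_sub sA sB,
    Summable.tsum_sub sD sE, hA, hB, hD, hE]
  ring

/-- **(3.27)** p. 441 [PDF 31], its algebraic content for INFINITELY supported kernels — PROVED for every EVEN kernel C
on ξℤ^d with Σ_z|C(z)| < ∞ and Σ_z|z_ν||C(z)| < ∞ for all ν (ξ ≠ 0): the first member of (3.27) equals its last member
(`lhs327Of`, `sum328Of`, `rhs327` of the companion `B3Sect3VectorSelfEnergy`, whose `eq327_of_even_finsupp` is the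
finitely supported case; same route — translation y′ = z + y, the two p. 441 identities C(−z) = C(z) and
(∂^{ξ*}C)(−z) = (∂^ξC)(z), pair sums P(v) = Σ_zC(z)C(z+v) and the first-moment identity Σ_z z_νC(z)C(z+v) = −½v_νP(v) —
with every lattice sum now justified by the summability class). [cite: Balaban1983Higgs3, (3.27) p.441] -/
theorem eq327_of_even_summable (ξ τ : ℝ) (hξ : ξ ≠ 0) (C : ZSite d → ℝ) (hC : ∀ z, C (-z) = C z)
    (h0 : Summable fun z => |C z|) (h1 : ∀ ν, Summable fun z : ZSite d => |(z ν : ℝ)| * |C z|)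
    (y : ZSite d) (μ μ' ν : Fin d) :
    lhs327Of ξ τ C y μ μ' ν = rhs327 τ (sum328Of ξ C) μ μ' ν := by
  -- translate y′ = z + y, use evenness, expand the difference quotients
  have hsummand : ∀ z : ZSite d,
      ξ ^ d * (-(pdiffAdjZ ξ⁻¹ μ' C (y - (z + y)) * pdiffAdjZ ξ⁻¹ μ C (z + y - y) * (ξ * (((z + y) ν : ℤ) - (y ν : ℝ)))) +
        C (y - (z + y)) * pdiffZ ξ⁻¹ μ' (pdiffAdjZ ξ⁻¹ μ C) (z + y - y) * (ξ * (((z + y) ν : ℤ) - (y ν : ℝ)))) =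
      ξ ^ d * ξ⁻¹ * ((z ν : ℝ) * (C z * C (z + (unitVec μ' - unitVec μ))) -
        (z ν : ℝ) * (C (z + unitVec μ') * C (z - unitVec μ))) := by
    intro z
    rw [show y - (z + y) = -z by abel, show z + y - y = z by abel, pdiffAdjZ_neg_of_even _ _ C hC, hC]
    simp only [pdiffZ, pdiffAdjZ, Pi.add_apply, Int.cast_add]
    rw [show z + unitVec μ' - unitVec μ = z + (unitVec μ' - unitVec μ) by abel]
    field_simp
    ring
  have hL : lhs327Of ξ τ C y μ μ' ν =
      τ * (ξ ^ d * ξ⁻¹ * (∑' z : ZSite d, ((z ν : ℝ) * (C z * C (z + (unitVec μ' - unitVec μ))) -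
        (z ν : ℝ) * (C (z + unitVec μ') * C (z - unitVec μ))))) := by
    rw [lhs327Of, ← tsum_translate _ y]
    simp_rw [hsummand]
    rw [tsum_mul_left]
  -- the second sum, shifted by e_μ, is a first moment plus a pair sum
  have s1 : Summable (fun z : ZSite d => (z ν : ℝ) * (C z * C (z + (unitVec μ' - unitVec μ)))) := by
    simpa only [add_zero] using summable_coord_mul_translates h0 h1 ν 0 (unitVec μ' - unitVec μ)
  have s2 : Summable (fun z : ZSite d => (z ν : ℝ) * (C (z + unitVec μ') * C (z - unitVec μ))) := by
    simpa only [sub_eq_add_neg] using summable_coord_mul_translates h0 h1 ν (unitVec μ') (-unitVec μ)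
  have s3 : Summable (fun z : ZSite d => (z ν : ℝ) * (C z * C (z + (unitVec μ + unitVec μ')))) := by
    simpa only [add_zero] using summable_coord_mul_translates h0 h1 ν 0 (unitVec μ + unitVec μ')
  have s4 : Summable (fun z : ZSite d => (if ν = μ then (1 : ℝ) else 0) * (C z * C (z + (unitVec μ + unitVec μ')))) := by
    simpa only [add_zero] using (summable_mul_translates h0 0 (unitVec μ + unitVec μ')).mul_left _
  have hshift : ∑' z : ZSite d, (z ν : ℝ) * (C (z + unitVec μ') * C (z - unitVec μ)) =
      ∑' z : ZSite d, ((z ν : ℝ) * (C z * C (z + (unitVec μ + unitVec μ'))) +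
        (if ν = μ then (1 : ℝ) else 0) * (C z * C (z + (unitVec μ + unitVec μ')))) := by
    rw [← tsum_translate (fun z : ZSite d => (z ν : ℝ) * (C (z + unitVec μ') * C (z - unitVec μ))) (unitVec μ)]
    refine tsum_congr fun z => ?_
    simp only [Pi.add_apply, unitVec, Pi.single_apply, Int.cast_add, Int.cast_ite, Int.cast_one, Int.cast_zero]
    rw [show z + Pi.single μ (1 : ℤ) + Pi.single μ' 1 = z + (Pi.single μ 1 + Pi.single μ' 1) by abel,
      show z + Pi.single μ (1 : ℤ) - Pi.single μ 1 = z by abel]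
    ring
  have hM1 := moment_eq hC h0 h1 (unitVec μ' - unitVec μ) ν
  have hM2 := moment_eq hC h0 h1 (unitVec μ + unitVec μ') ν
  have hδ : ∑' z : ZSite d, (if ν = μ then (1 : ℝ) else 0) * (C z * C (z + (unitVec μ + unitVec μ'))) =
      (if ν = μ then (1 : ℝ) else 0) * ∑' z : ZSite d, C z * C (z + (unitVec μ + unitVec μ')) := by
    rw [← tsum_mul_left]
  rw [hL, Summable.tsum_sub s1 s2, hshift, Summable.tsum_add s3 s4, hM1, hM2, hδ, rhs327,
    sum328Of_eq_pairC ξ h0 μ μ', sum328Of_eq_pairC ξ h0 μ' μ,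
    show unitVec μ - unitVec μ' = -(unitVec μ' - unitVec μ) by abel, pairC_neg, add_comm (unitVec μ') (unitVec μ)]
  simp only [unitVec, Pi.sub_apply, Pi.add_apply, Pi.single_apply, Int.cast_sub, Int.cast_add, Int.cast_ite,
    Int.cast_one, Int.cast_zero]
  rcases eq_or_ne ν μ with h1' | h1' <;> rcases eq_or_ne ν μ' with h2' | h2'
  · subst h1'; subst h2'
    simp only [if_true]
    ring
  · subst h1'
    simp only [if_true, h2', Ne.symm h2', if_false]
    ring
  · subst h2'
    simp only [if_true, h1', Ne.symm h1', if_false]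
    ring
  · simp only [h1', h2', Ne.symm h1', Ne.symm h2', if_false]
    ring

end SummableKernels

/-! ## 2. (3.27) for C^ξ itself -/

section Cxi

/-- kernel: |z_ν| ≤ |z|₁ (one coordinate against the ℓ¹ size). [folklore] -/
private theorem abs_coord_le_l1 (z : ZSite d) (ν : Fin d) : |(z ν : ℝ)| ≤ (l1 z : ℝ) := by
  unfold l1
  push_cast
  have h : |(z ν : ℝ)| = (((z ν).natAbs : ℕ) : ℝ) := by
    rw [Nat.cast_natAbs, Int.cast_abs]
  rw [h]
  exact Finset.single_le_sum (f := fun μ => (((z μ).natAbs : ℕ) : ℝ)) (fun μ _ => by positivity) (Finset.mem_univ ν)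

/-- kernel: C^ξ is in the summability class — Σ|C^ξ| < ∞. [cite: Balaban1983Higgs3, (3.27) p.441] -/
theorem summable_abs_Cxi {ξ : ℝ} (hξ : 0 < ξ) : Summable fun z : ZSite d => |Cxi d ξ z| :=
  (summable_Cxi hξ).congr fun z => (abs_of_nonneg (Cxi_nonneg hξ z)).symm

/-- kernel: C^ξ is in the summability class — Σ|z_ν||C^ξ(z)| < ∞ for every ν. [cite: Balaban1983Higgs3, (3.27) p.441] -/
theorem summable_coord_mul_Cxi {ξ : ℝ} (hξ : 0 < ξ) (ν : Fin d) :
    Summable fun z : ZSite d => |(z ν : ℝ)| * |Cxi d ξ z| := by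
  have h := summable_weight_Cxi (d := d) hξ 1
  simp only [pow_one] at h
  refine Summable.of_nonneg_of_le (fun z => mul_nonneg (abs_nonneg _) (abs_nonneg _)) (fun z => ?_) h
  rw [abs_of_nonneg (Cxi_nonneg hξ z)]
  exact mul_le_mul_of_nonneg_right ((abs_coord_le_l1 z ν).trans (by linarith)) (Cxi_nonneg hξ z)

/-- **(3.27)** p. 441 [PDF 31] FOR C^ξ ITSELF — PROVED (ξ > 0): the typed display `Eq327 d ξ τ` of the companion
`B3Sect3VectorSelfEnergy` (first member = last member, verbatim: *"tr q² Σ_{y′} ξ^d[−(C^ξ∂^{ξ*}_{μ′})(y−y′)(C^ξ∂^{ξ*}_μ)(y′−y)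
(y′_ν−y_ν) + C^ξ(y−y′)(∂^ξ_{μ′}C^ξ∂^{ξ*}_μ)(y′−y)(y′_ν−y_ν)] = … = ½ tr q² Σ_{y′} ξ^d(C^ξ(y′+ξe_μ) − C^ξ(y′−ξe_μ))(∂^ξ_{μ′}C^ξ)(y′)
δ_{μν} − (μ↔μ′). (3.27)"*) holds for the momentum-integral C^ξ = (−Δ^ξ + 1)^{−1}: the convergence bookkeeping (T5 of the
companion) is discharged by `B3CxiPropagator.summable_weight_Cxi` (C^ξ ≥ 0, Σ_y(1 + |y|₁)C^ξ(y) < ∞ via the Neumann series).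
[cite: Balaban1983Higgs3, (3.27) p.441] -/
theorem eq327_holds {ξ : ℝ} (hξ : 0 < ξ) (τ : ℝ) : Eq327 d ξ τ := by
  intro y μ μ' ν
  have hS : sum328 d ξ = sum328Of ξ (Cxi d ξ) := by
    funext a b; exact sum328_eq_of ξ a b
  rw [lhs327_eq_of, hS]
  exact eq327_of_even_summable ξ τ hξ.ne' (Cxi d ξ) (Cxi_neg ξ) (summable_abs_Cxi hξ) (summable_coord_mul_Cxi hξ)
    y μ μ' ν

/-- p. 441, *"hence finally the term (3.27) is equal to 0"* — with (3.27) now PROVED for C^ξ, the vanishing of the first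
member of (3.27) for every (μ, μ′, ν) follows from the diagonality δ_{μμ′} of (3.28) ALONE (`Eq328 d ξ`, whose second equality is
the companion's `eq328_second`; its first equality — lattice sum = momentum integral — is the remaining input).
[cite: Balaban1983Higgs3, (3.28) p.441] -/
theorem lhs327_eq_zero_of_eq328' {ξ : ℝ} (hξ : 0 < ξ) (τ : ℝ) (h328 : Eq328 d ξ) (y : ZSite d) (μ μ' ν : Fin d) :
    lhs327 d ξ τ y μ μ' ν = 0 :=
  lhs327_eq_zero_of_eq328 τ (eq327_holds hξ τ) h328 y μ μ' ν

end Cxi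

/-! ## 3. v1.1 — "hence finally the term (3.27) is equal to 0", unconditionally for C^ξ -/

section Vanishing

/-- p. 441 [PDF 31], verbatim: *"… (3.28) which is symmetric in μ, μ′, hence finally the term (3.27) is equal to 0."* — PROVED
UNCONDITIONALLY for the free propagator C^ξ = (−Δ^ξ + 1)^{−1} on ξℤ^d (ξ > 0): the first member of (3.27) (`lhs327`, tr q² = τ)
vanishes for every site y and all directions μ, μ′, ν.  Assembly of (3.27) for C^ξ (`eq327_holds`, this file: position-space
summability via the Neumann series of `B3CxiPropagator`), (3.28) for C^ξ (seat p03's `B3Eq324Parseval.eq328_holds`: Plancherel on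
ξℤ^d + the reflection/transposition symmetry of the momentum integral, whence S(μ,μ′) ∝ δ_{μμ′}) and the diagonal-vanishing step
`lhs327_eq_zero_of_eq328` of the companion. [cite: Balaban1983Higgs3, (3.28) p.441] -/
theorem lhs327_Cxi_eq_zero {ξ : ℝ} (hξ : 0 < ξ) (τ : ℝ) (y : ZSite d) (μ μ' ν : Fin d) :
    lhs327 d ξ τ y μ μ' ν = 0 :=
  lhs327_eq_zero_of_eq328' hξ τ (B3Eq324Parseval.eq328_holds hξ) y μ μ' ν

/-- kernel: equivalently, (3.27) for C^ξ in its printed three-member form «first member = last member = 0»: the last member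
½ tr q² S(μ,μ′)δ_{μν} − (μ↔μ′) vanishes as well (S diagonal by (3.28)). [cite: Balaban1983Higgs3, (3.27) p.441] -/
theorem rhs327_Cxi_eq_zero {ξ : ℝ} (hξ : 0 < ξ) (τ : ℝ) (μ μ' ν : Fin d) :
    rhs327 τ (sum328 d ξ) μ μ' ν = 0 :=
  rhs327_eq_zero_of_diag τ _ (fun _ _ hne => sum328_offDiag (B3Eq324Parseval.eq328_holds hξ) hne) μ μ' ν

end Vanishing

/-! ## 4. v1.2: the printed MIDDLE member of (3.27) -/

section Middle

variable {C : ZSite d → ℝ}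

/-- kernel: forward and backward difference quotients in different (or equal) directions commute,
∂^ξ_{μ′}∂^{ξ*}_μ f = ∂^{ξ*}_μ∂^ξ_{μ′} f (constant coefficients on ℤ^d). [folklore] -/
private theorem pdiffZ_pdiffAdjZ_comm (a b : ℝ) (μ μ' : Fin d) (f : ZSite d → ℝ) (z : ZSite d) :
    pdiffZ a μ' (pdiffAdjZ b μ f) z = pdiffAdjZ b μ (pdiffZ a μ' f) z := by
  simp only [pdiffZ, pdiffAdjZ]
  rw [show z + unitVec μ' - unitVec μ = z - unitVec μ + unitVec μ' by abel]
  ring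

/-- kernel (the two printed identities, iterated): (∂^ξ_{μ′}∂^{ξ*}_μC)(−z) = (∂^{ξ*}_{μ′}∂^ξ_μC)(z) for an even kernel C.
[cite: Balaban1983Higgs3, (3.27) p.441] -/
theorem pdiffZ_pdiffAdjZ_neg_of_even (a b : ℝ) (μ μ' : Fin d) (f : ZSite d → ℝ) (hf : ∀ y, f (-y) = f y)
    (z : ZSite d) : pdiffZ a μ' (pdiffAdjZ b μ f) (-z) = pdiffAdjZ a μ' (pdiffZ b μ f) z := by
  have h1 : pdiffAdjZ b μ f (-z + unitVec μ') = pdiffZ b μ f (z - unitVec μ') := by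
    rw [show -z + unitVec μ' = -(z - unitVec μ') by abel, pdiffAdjZ_neg_of_even b μ f hf]
  have h2 : pdiffAdjZ b μ f (-z) = pdiffZ b μ f z := pdiffAdjZ_neg_of_even b μ f hf z
  show a * (pdiffAdjZ b μ f (-z + unitVec μ') - pdiffAdjZ b μ f (-z)) =
    a * (pdiffZ b μ f (z - unitVec μ') - pdiffZ b μ f z)
  rw [h1, h2]

/-- The MIDDLE member of **(3.27)** p. 441 [PDF 31], verbatim (page render): *"= ½ tr q² Σ_{y′} ξ^d[−(∂^{ξ*}_μC^ξ)(y′)(∂^ξ_{μ′}C^ξ)(y′)y′_ν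
+ C^ξ(y′)(∂^{ξ*}_μ∂^ξ_{μ′}C^ξ)(y′)y′_ν + (∂^ξ_μC^ξ)(y′)(∂^{ξ*}_{μ′}C^ξ)(y′)y′_ν − C^ξ(y′)(∂^{ξ*}_{μ′}∂^ξ_μC^ξ)(y′)y′_ν]"* — for an
arbitrary kernel C on ξℤ^d (tr q² is the real number τ; physical coordinate y′_ν = ξ·y′_ν for the integer coordinates of
`ZSite`, as in `lhs327Of`; the sum no longer involves the external point y — the translation y′ − y ↦ y′ has been made).
[cite: Balaban1983Higgs3, (3.27) p.441] -/
noncomputable def mid327Of (ξ τ : ℝ) (C : ZSite d → ℝ) (μ μ' ν : Fin d) : ℝ :=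
  1 / 2 * τ * ∑' y' : ZSite d, ξ ^ d *
    (-(pdiffAdjZ ξ⁻¹ μ C y' * pdiffZ ξ⁻¹ μ' C y' * (ξ * (y' ν : ℝ))) +
      C y' * pdiffAdjZ ξ⁻¹ μ (pdiffZ ξ⁻¹ μ' C) y' * (ξ * (y' ν : ℝ)) +
      pdiffZ ξ⁻¹ μ C y' * pdiffAdjZ ξ⁻¹ μ' C y' * (ξ * (y' ν : ℝ)) -
      C y' * pdiffAdjZ ξ⁻¹ μ' (pdiffZ ξ⁻¹ μ C) y' * (ξ * (y' ν : ℝ)))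

/-- The middle member of **(3.27)** for the free propagator C^ξ itself (`Cxi`). [cite: Balaban1983Higgs3, (3.27) p.441] -/
noncomputable def mid327 (d : ℕ) (ξ τ : ℝ) (μ μ' ν : Fin d) : ℝ :=
  mid327Of ξ τ (Cxi d ξ) μ μ' ν

/-- kernel: `mid327` is `mid327Of` at C = C^ξ. [cite: Balaban1983Higgs3, (3.27) p.441] -/
theorem mid327_eq_of (ξ τ : ℝ) (μ μ' ν : Fin d) : mid327 d ξ τ μ μ' ν = mid327Of ξ τ (Cxi d ξ) μ μ' ν := rfl

/-- **(3.27)** p. 441 [PDF 31], FIRST member = MIDDLE member — PROVED for every EVEN kernel C of the summability class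
(Σ_z|C(z)| < ∞, Σ_z|z_ν||C(z)| < ∞), ξ ≠ 0: exactly the printed step *"We have used the identities C^ξ(−y′) = C^ξ(y′),
(∂^ξ_μC^ξ)(−y′) = (∂^{ξ*}_μC^ξ)(y′)"* — translate y′ ↦ y′ + y, rewrite the kernels at −y′ by the two identities (and their
iterate `pdiffZ_pdiffAdjZ_neg_of_even`), and average the resulting sum with its reflection y′ ↦ −y′ (both converge absolutely
in the summability class). [cite: Balaban1983Higgs3, (3.27) p.441] -/
theorem lhs327Of_eq_mid327Of (ξ τ : ℝ) (hξ : ξ ≠ 0) (C : ZSite d → ℝ) (hC : ∀ z, C (-z) = C z)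
    (h0 : Summable fun z => |C z|) (h1 : ∀ ν, Summable fun z : ZSite d => |(z ν : ℝ)| * |C z|)
    (y : ZSite d) (μ μ' ν : Fin d) :
    lhs327Of ξ τ C y μ μ' ν = mid327Of ξ τ C μ μ' ν := by
  -- the translated first-member summand, in the paper's "derivative" form
  set F : ZSite d → ℝ := fun z => ξ ^ d *
    (-(pdiffZ ξ⁻¹ μ' C z * pdiffAdjZ ξ⁻¹ μ C z * (ξ * (z ν : ℝ))) +
      C z * pdiffZ ξ⁻¹ μ' (pdiffAdjZ ξ⁻¹ μ C) z * (ξ * (z ν : ℝ))) with hFdef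
  -- (a) translation y′ = z + y and the two printed identities at −z
  have hL : lhs327Of ξ τ C y μ μ' ν = τ * ∑' z : ZSite d, F z := by
    rw [lhs327Of, ← tsum_translate _ y]
    congr 1
    refine tsum_congr fun z => ?_
    rw [show y - (z + y) = -z by abel, show z + y - y = z by abel, pdiffAdjZ_neg_of_even _ _ C hC, hC]
    simp only [hFdef, Pi.add_apply, Int.cast_add, add_sub_cancel_right]
  -- (b) the same summand in pair form, for the convergence bookkeeping of §1
  have hFpair : ∀ z : ZSite d, F z = ξ ^ d * ξ⁻¹ * ((z ν : ℝ) * (C z * C (z + (unitVec μ' - unitVec μ))) -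
      (z ν : ℝ) * (C (z + unitVec μ') * C (z - unitVec μ))) := by
    intro z
    simp only [hFdef, pdiffZ, pdiffAdjZ]
    rw [show z + unitVec μ' - unitVec μ = z + (unitVec μ' - unitVec μ) by abel]
    field_simp
    ring
  have s1 : Summable (fun z : ZSite d => (z ν : ℝ) * (C z * C (z + (unitVec μ' - unitVec μ)))) := by
    simpa only [add_zero] using summable_coord_mul_translates h0 h1 ν 0 (unitVec μ' - unitVec μ)
  have s2 : Summable (fun z : ZSite d => (z ν : ℝ) * (C (z + unitVec μ') * C (z - unitVec μ))) := by
    simpa only [sub_eq_add_neg] using summable_coord_mul_translates h0 h1 ν (unitVec μ') (-unitVec μ)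
  have hFs : Summable F := by
    refine (((s1.sub s2).mul_left (ξ ^ d * ξ⁻¹))).congr fun z => ?_
    exact (hFpair z).symm
  have hFns : Summable fun z : ZSite d => F (-z) := (Equiv.neg (ZSite d)).summable_iff.mpr hFs
  -- (c) the reflected summand, by the printed identities (and their iterate)
  have hFneg : ∀ z : ZSite d, F (-z) = ξ ^ d *
      (pdiffAdjZ ξ⁻¹ μ' C z * pdiffZ ξ⁻¹ μ C z * (ξ * (z ν : ℝ)) -
        C z * pdiffAdjZ ξ⁻¹ μ' (pdiffZ ξ⁻¹ μ C) z * (ξ * (z ν : ℝ))) := by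
    intro z
    simp only [hFdef]
    rw [pdiffZ_neg_of_even _ _ C hC, pdiffAdjZ_neg_of_even _ _ C hC, pdiffZ_pdiffAdjZ_neg_of_even _ _ μ μ' C hC, hC]
    simp only [Pi.neg_apply, Int.cast_neg]
    ring
  -- (d) the printed middle summand is the average of the summand and its reflection
  have hM : mid327Of ξ τ C μ μ' ν = 1 / 2 * τ * ∑' z : ZSite d, (F z + F (-z)) := by
    unfold mid327Of
    congr 1
    refine tsum_congr fun z => ?_
    rw [hFneg z]
    simp only [hFdef]
    rw [pdiffZ_pdiffAdjZ_comm]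
    ring
  have hrefl : ∑' z : ZSite d, F (-z) = ∑' z : ZSite d, F z := Equiv.tsum_eq (Equiv.neg (ZSite d)) F
  rw [hL, hM, hFs.tsum_add hFns, hrefl]
  ring

/-- **(3.27)** p. 441 [PDF 31], MIDDLE member = LAST member (*"… and the integration by parts formula"*) — PROVED for every
even kernel of the summability class (ξ ≠ 0), by §1 (`eq327_of_even_summable`) and the preceding theorem.
[cite: Balaban1983Higgs3, (3.27) p.441] -/
theorem mid327Of_eq_rhs327 (ξ τ : ℝ) (hξ : ξ ≠ 0) (C : ZSite d → ℝ) (hC : ∀ z, C (-z) = C z)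
    (h0 : Summable fun z => |C z|) (h1 : ∀ ν, Summable fun z : ZSite d => |(z ν : ℝ)| * |C z|)
    (μ μ' ν : Fin d) :
    mid327Of ξ τ C μ μ' ν = rhs327 τ (sum328Of ξ C) μ μ' ν := by
  rw [← lhs327Of_eq_mid327Of ξ τ hξ C hC h0 h1 0 μ μ' ν]
  exact eq327_of_even_summable ξ τ hξ C hC h0 h1 0 μ μ' ν

/-- **(3.27) FOR C^ξ, the printed three-member chain, first step** (ξ > 0): first member = middle member.
[cite: Balaban1983Higgs3, (3.27) p.441] -/
theorem lhs327_eq_mid327 {ξ : ℝ} (hξ : 0 < ξ) (τ : ℝ) (y : ZSite d) (μ μ' ν : Fin d) :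
    lhs327 d ξ τ y μ μ' ν = mid327 d ξ τ μ μ' ν := by
  rw [lhs327_eq_of, mid327_eq_of]
  exact lhs327Of_eq_mid327Of ξ τ hξ.ne' (Cxi d ξ) (Cxi_neg ξ) (summable_abs_Cxi hξ)
    (summable_coord_mul_Cxi hξ) y μ μ' ν

/-- **(3.27) FOR C^ξ, the printed three-member chain, second step** (ξ > 0): middle member = last member.
[cite: Balaban1983Higgs3, (3.27) p.441] -/
theorem mid327_eq_rhs327 {ξ : ℝ} (hξ : 0 < ξ) (τ : ℝ) (μ μ' ν : Fin d) :
    mid327 d ξ τ μ μ' ν = rhs327 τ (sum328 d ξ) μ μ' ν := by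
  have h328 : sum328 d ξ = sum328Of ξ (Cxi d ξ) := rfl
  rw [mid327_eq_of, h328]
  exact mid327Of_eq_rhs327 ξ τ hξ.ne' (Cxi d ξ) (Cxi_neg ξ) (summable_abs_Cxi hξ) (summable_coord_mul_Cxi hξ) μ μ' ν

/-- kernel: hence the middle member of (3.27) for C^ξ vanishes as well (ξ > 0), with (3.28) (`B3Eq324Parseval.eq328_holds`).
[cite: Balaban1983Higgs3, (3.28) p.441] -/
theorem mid327_eq_zero {ξ : ℝ} (hξ : 0 < ξ) (τ : ℝ) (μ μ' ν : Fin d) : mid327 d ξ τ μ μ' ν = 0 := by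
  rw [mid327_eq_rhs327 hξ]
  exact rhs327_Cxi_eq_zero hξ τ μ μ' ν

end Middle

end Literature.MathematicalPhysics.QuantumFieldTheory.Balaban1983to89.B3Eq327Cxi
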